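import Summits.QuantumFields.BalabanUV.Beta.GAN24.LegPushGaugeSplit
import Summits.QuantumFields.BalabanUV.Beta.GAN24.ThreeLegSupBound
import Summits.QuantumFields.BalabanUV.Beta.GAN24.Lin4LegTower
import Summits.QuantumFields.BalabanUV.Beta.GAN24.SlotDivergenceLetters
import Literature.MathematicalPhysics.QuantumFieldTheory.Balaban1983to89.B6AxialGaugeDictionary

/-!
# `BalabanUV.Beta.GAN24.LegPushGaugePairings` — binder row G-an2-4 ∕ (CONV-C), W-slot, the (α-0) parity re-cut, located crux (Q-L-k₀) (RULING R-gan24p1-g36-1 (4d)):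
# **THE THREE GAUGE PAIRINGS OF THE DRESSED SLOT LEGS ARE `sup × sup × sup × (divergence row)` — `Cg(k₀)·g′` TERMS, NO FREEZING.**
The three extra terms of `LegPushGaugeSplit.vertex2W_dressed_eq` (dressing both slot legs `r ↦ r + d_z φ` of the two-slot vertex pairing of a
BLOCK-SUMMED table `bsum L ∘ W`), each paired against a kernel weight `ρ` and evaluated at one output entry, priced by the naive three-leg bound
`ThreeLegSupBound.abs_threeLeg_sup_le` (all weights by their SUP envelopes at blocking `L`; the table enters only through its slot-DIVERGENCE rows `g′`):
* (A, second bond)  `|Σ'_x ρ x·(vertexW r P₂ μ₀ y₀)(x,y,f,b)| ≤ (d+1)·a_ρ·a·a_φ·g′·K`,  `P₂ κ v := Σ'_w′ φ ν₀ y₀′ w′ • divV (bsum L ∘ W κ v) w′`;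
* (B, first bond)   `|Σ'_x ρ x·Σ'_w φ μ₀ y₀ w·divV (κ u ↦ vertexW r (bsum L ∘ W κ u) ν₀ y₀′) w (x,y,f,b)| ≤ (d+1)·a_ρ·a_φ·a·g′·K`;
* (C, both bonds)   `|Σ'_x ρ x·Σ'_w φ μ₀ y₀ w·divV P₂ w (x,y,f,b)| ≤ a_ρ·a_φ·a_φ′·(d+1)·g′·(e^{3δ}+1)·K`,
with `K := e^{5κ₀}·Zl(δ/2)³·L^{d+1}·Zl(κ₀/(2(d+1)))·e^{−(κ₀/6)(‖y₀′−y₀‖∞+‖x′−y₀‖∞+‖y−y₀‖∞)}` under `0 < κ₀ ≤ (δ/6)·L` (every summand summable).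
In the (H1♮) window of RULING R-gan24p1-g36-1 these are the `Cg·g` part: `g′` = the GoodL slot-divergence rows, `a` = leaf-12's composite-leg sup envelope,
`a_φ` = the gauge potential's (`DressedLegEnvelope.Psi_single_envelope`), `a_ρ` = the kernel leg's.

NOT IN PRINT; OUR PROOF ([folklore]; 0 `def`, 0 cited facts, 0 `def … : Prop`, 0 sorry, 0 wall binders).  HONEST FRAMING (cell contract, verbatim): «discharging
`BetaPertH` makes Bałaban's UV stability UNCONDITIONAL — a real constructive-QFT result; it is NOT the continuum limit and NOT the Clay problem.»  HONEST DEPENDENCY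
(verbatim): «continuum YM on T⁴ ⇐ BetaPertH ∧ nine spine estimates (0/9 proved); BetaPertH ⇐ (D1) ∧ (D4) ∧ CAP+tail; G-an2-4 gates asym, D1 and NE2/3/4.»

* helpers `divV_bsum_entry`, `summable_env_mul`, (`e^{−δ|a−(w−e_μ)|₁} ≤ e^{δ}·e^{−δ|a−w|₁}` = `SlotDivergenceLetters.exp_shift_unit_le` BY NAME), `divV_vertexW_bsum_entry`, `divV_P₂_bsum_entry`
  (the entrywise reshaping of each pairing into `Σ_fibre` of the scalar shape `Σ'_x ρ·Σ'_v h₁·Σ'_w h₂·Σ_t T(v,w,x,L•y+t)`);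
* **`abs_pairingA_le`**, **`abs_pairingB_le`**, **`abs_pairingC_le`** (as displayed; hypotheses: the envelopes, `W` bounded (B, C), the divergence rows
  `|Σ_μ (W κ v μ (w−e_μ) − W κ v μ w)(x,p,f,b)| ≤ g′·e^{−δ|w−v|₁}·e^{−δ(|x−v|₁+|p−v|₁)}` (A, C) ∕ `|Σ_κ (W κ (w−e_κ) κ′ v′ − W κ w κ′ v′)(x,p,f,b)| ≤ g′·e^{−δ|v′−w|₁}·…` (B)).
The next file `LegPushDressedBound` sums the three over the finite fibres of one `legPush` entry (`LegStepPush` §2 pattern, both orderings) and adds them to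
`LegStepPush.locStencil₂_legPush_bsum`'s constant — the (E-a) window `locStencil₂_legPush_dressed_bsum`.
NOT (H1♮); NEVER «G-an2-4 closed» as (CONV-C); NOT D1, NOT `BetaPertH`, NOT continuum, NOT Clay; not in print.
Unit `b2b-balaban-gan24-formalise-leaf-01` (G-an2-4 formalisation swarm, leaf prover 01, gen 74), 2026-08-23.
-/

noncomputable section

open Finset
open scoped BigOperators
open Literature.MathematicalPhysics.QuantumFieldTheory.LatticeForm (quo)
open Literature.MathematicalPhysics.QuantumFieldTheory.Balaban1983to89
open Literature.MathematicalPhysics.QuantumFieldTheory.Balaban1983to89.Beta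
open B4ContourShift (supNorm)
open B6BondElimination (unitVec)
open B6AxialGaugeDictionary (unitVec_eq)
open Summit.QuantumFields.BalabanUV.Beta.GAN24.SlotDivergenceLetters (exp_shift_unit_le)
open B12Sec2to5 (l1 l1_nonneg)
open ExpKernelCalculus (MKer Zl Zl_nonneg Zl_pos l1_sub_triangle l1_sub_symm)
open OneStepResolventKernel (Fib)
open AffineAveraging (box toSite)
open KernelWard (divV)
open Summit.QuantumFields.BalabanUV.Beta.GAN24.BiStencilZeroMode (Tab)
open Summit.QuantumFields.BalabanUV.Beta.GAN24.Push4 (vertexW vertexW_apply vertex2W)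
open BalabanCompositeJets (LocStencil₂ LocStencil₂.nonneg)
open Summit.QuantumFields.BalabanUV.Beta.GAN24.LegStepPush (abs_legPush_bsum_inl_le)
open Summit.QuantumFields.BalabanUV.Beta.GAN24.LegStepPush (legPush legPush_inl legPush_inr supNorm_sub_comm)
open Summit.QuantumFields.BalabanUV.Beta.GAN24.LegPushNestAux (abs_vertexW_le_of_bdd)
open Summit.QuantumFields.BalabanUV.Beta.GAN24.LegPushGaugeSplit (vertex2W_dressed_eq)
open Summit.QuantumFields.BalabanUV.Beta.GAN24.ThreeLegDoubleFreezeSummable (locStencil₂_of_env_bound)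
open B4Reflection242 (supNorm_add_le)
open B4ContourShift (supNorm_nonneg)
open Summit.QuantumFields.BalabanUV.Beta.GAN24.Lin4LegTower (bsum bsum_apply)
open Summit.QuantumFields.BalabanUV.Beta.GAN24.EnvelopeBlockSum (env_le_one summable_env)
open Summit.QuantumFields.BalabanUV.Beta.GAN24.LegPushGaugeSplit (divV_apply_entry)
open Summit.QuantumFields.BalabanUV.Beta.GAN24.ThreeLegSupBound (middle_sup_le abs_threeLeg_sup_le)

namespace Summit.QuantumFields.BalabanUV.Beta.GAN24.LegPushGaugePairings

variable {d : ℕ}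

/-- [folklore] **THE SECOND-BOND DIVERGENCE OF A BLOCK-SUMMED TABLE, ENTRYWISE, IS THE BLOCK SUM OF THE SECOND-BOND DIVERGENCE ROW.** -/
theorem divV_bsum_entry (W : Tab d) (L : ℕ) (κ : Fin (d + 1)) (v w x y : Fin (d + 1) → ℤ) (f b : Fib d) :
    divV (fun μ w => bsum L (W κ v μ w)) w x y f b
      = ∑ t ∈ box (d + 1) L, ∑ μ, (W κ v μ (w - unitVec μ) x ((L : ℤ) • y + toSite t) f b - W κ v μ w x ((L : ℤ) • y + toSite t) f b) := by
  rw [divV_apply_entry, Finset.sum_comm]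
  simp only [bsum_apply, Finset.sum_sub_distrib]

/-- [folklore] A weight under an `L`-block envelope times a bounded factor is summable. -/
theorem summable_env_mul {L : ℕ} (hL : 1 ≤ L) {κ₀ a M : ℝ} (hκ : 0 < κ₀) {c : Fin (d + 1) → ℤ} {h F : (Fin (d + 1) → ℤ) → ℝ}
    (hh : ∀ v, |h v| ≤ a * Real.exp (-(κ₀ * supNorm (quo L v - c)))) (hF : ∀ v, |F v| ≤ M) : Summable fun v => h v * F v := by
  refine Summable.of_norm_bounded (((summable_env hL hκ c).mul_left a).mul_right M) fun v => ?_
  rw [Real.norm_eq_abs, abs_mul]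
  exact mul_le_mul (hh v) (hF v) (abs_nonneg _) ((abs_nonneg _).trans (hh v))

section PairingA

variable {L : ℕ} {κ₀ δ a aφ aρ g' CW : ℝ}
  {r : Fin (d + 1) → (Fin (d + 1) → ℤ) → Fin (d + 1) → (Fin (d + 1) → ℤ) → ℝ}
  {φ : Fin (d + 1) → (Fin (d + 1) → ℤ) → (Fin (d + 1) → ℤ) → ℝ} {ρ : (Fin (d + 1) → ℤ) → ℝ} {W : Tab d}
  {μ₀ : Fin (d + 1)} {y₀ : Fin (d + 1) → ℤ} {ν₀ : Fin (d + 1)} {y₀' : Fin (d + 1) → ℤ} {x' y : Fin (d + 1) → ℤ} {f b : Fib d}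
  (hL : 1 ≤ L) (hκ : 0 < κ₀) (hδ : 0 < δ) (hgap : κ₀ ≤ δ / 6 * L)
  (ha : 0 ≤ a) (haφ : 0 ≤ aφ) (haρ : 0 ≤ aρ) (hg : 0 ≤ g')
  (hr : ∀ κ v, |r μ₀ y₀ κ v| ≤ a * Real.exp (-(κ₀ * supNorm (quo L v - y₀))))
  (hφ : ∀ w, |φ ν₀ y₀' w| ≤ aφ * Real.exp (-(κ₀ * supNorm (quo L w - y₀'))))
  (hρ : ∀ x, |ρ x| ≤ aρ * Real.exp (-(κ₀ * supNorm (quo L x - x'))))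
  (hD : ∀ κ v w x p, |∑ μ, (W κ v μ (w - unitVec μ) x p f b - W κ v μ w x p f b)|
    ≤ g' * Real.exp (-δ * l1 (w - v)) * Real.exp (-δ * (l1 (x - v) + l1 (p - v))))

include hL hκ hδ hgap ha haφ haρ hg hr hφ hρ hD in
/-- NOT IN PRINT; OUR PROOF.  **THE SECOND-BOND GAUGE PAIRING IS A `Cg·g′` TERM**: with `P₂ κ v := Σ'_w φ ν₀ y₀′ w • divV (bsum L ∘ W κ v) w`,
`|Σ'_x ρ x·(vertexW r P₂ μ₀ y₀) x y f b| ≤ (d+1)·a_ρ·a·a_φ·g′·e^{5κ₀}·Zl(δ/2)³·L^{d+1}·Zl(κ₀/(2(d+1)))·e^{−(κ₀/6)(‖y₀′−y₀‖∞+‖x′−y₀‖∞+‖y−y₀‖∞)}` (and the summand is summable). -/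
theorem abs_pairingA_le :
    (Summable fun x => ρ x * vertexW r (fun κ v => fun x z f b => ∑' w, φ ν₀ y₀' w * divV (fun μ w => bsum L (W κ v μ w)) w x z f b) μ₀ y₀ x y f b) ∧
    |∑' x, ρ x * vertexW r (fun κ v => fun x z f b => ∑' w, φ ν₀ y₀' w * divV (fun μ w => bsum L (W κ v μ w)) w x z f b) μ₀ y₀ x y f b|
      ≤ ((d : ℝ) + 1) * (aρ * a * aφ * g' * Real.exp κ₀ ^ 5 * Zl (d + 1) (δ / 2) ^ 3 *
        ((L : ℝ) ^ (d + 1) * Zl (d + 1) (κ₀ / (2 * ((d : ℝ) + 1))) *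
          Real.exp (-(κ₀ / 6) * (supNorm (y₀' - y₀) + supNorm (x' - y₀) + supNorm (y - y₀))))) := by
  -- per fibre `κ`: the scalar three-leg sum of `ThreeLegSupBound`
  have hT : ∀ κ v w x p, |(fun v w x p => ∑ μ, (W κ v μ (w - unitVec μ) x p f b - W κ v μ w x p f b)) v w x p|
      ≤ g' * Real.exp (-δ * l1 (w - v)) * Real.exp (-δ * (l1 (x - v) + l1 (p - v))) := fun κ v w x p => hD κ v w x p
  have core := fun κ => abs_threeLeg_sup_le (h₁ := fun v => r μ₀ y₀ κ v) (h₂ := fun w => φ ν₀ y₀' w) (ρ := ρ)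
    (T := fun v w x p => ∑ μ, (W κ v μ (w - unitVec μ) x p f b - W κ v μ w x p f b)) (c₁ := y₀) (c₂ := y₀') (c₃ := x') (c₄ := y)
    hL hκ hδ hgap ha haφ haρ hg (fun v => hr κ v) hφ hρ (hT κ)
  have mid := fun κ x => middle_sup_le (h₁ := fun v => r μ₀ y₀ κ v) (h₂ := fun w => φ ν₀ y₀' w)
    (T := fun v w x p => ∑ μ, (W κ v μ (w - unitVec μ) x p f b - W κ v μ w x p f b)) (c₁ := y₀) (c₂ := y₀') (c₄ := y)
    hL hκ hδ hgap ha haφ hg (fun v => hr κ v) hφ (hT κ) x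
  -- the vertex entry as a finite sum over `κ` of the scalar slot layers
  have eV : ∀ x, ρ x * vertexW r (fun κ v => fun x z f b => ∑' w, φ ν₀ y₀' w * divV (fun μ w => bsum L (W κ v μ w)) w x z f b) μ₀ y₀ x y f b
      = ∑ κ, ρ x * ∑' v, r μ₀ y₀ κ v * ∑' w, φ ν₀ y₀' w * ∑ t ∈ box (d + 1) L,
          ∑ μ, (W κ v μ (w - unitVec μ) x ((L : ℤ) • y + toSite t) f b - W κ v μ w x ((L : ℤ) • y + toSite t) f b) := by
    intro x
    rw [vertexW_apply, Finset.mul_sum]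
    simp only [divV_bsum_entry]
  simp_rw [eV]
  refine ⟨summable_sum fun κ _ => (core κ).1, ?_⟩
  rw [Summable.tsum_finsetSum (fun κ _ => (core κ).1)]
  calc |∑ κ, ∑' x, ρ x * ∑' v, r μ₀ y₀ κ v * ∑' w, φ ν₀ y₀' w * ∑ t ∈ box (d + 1) L,
          ∑ μ, (W κ v μ (w - unitVec μ) x ((L : ℤ) • y + toSite t) f b - W κ v μ w x ((L : ℤ) • y + toSite t) f b)|
      ≤ ∑ κ, |∑' x, ρ x * ∑' v, r μ₀ y₀ κ v * ∑' w, φ ν₀ y₀' w * ∑ t ∈ box (d + 1) L,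
          ∑ μ, (W κ v μ (w - unitVec μ) x ((L : ℤ) • y + toSite t) f b - W κ v μ w x ((L : ℤ) • y + toSite t) f b)| := Finset.abs_sum_le_sum_abs _ _
    _ ≤ ∑ _κ : Fin (d + 1), aρ * a * aφ * g' * Real.exp κ₀ ^ 5 * Zl (d + 1) (δ / 2) ^ 3 *
        ((L : ℝ) ^ (d + 1) * Zl (d + 1) (κ₀ / (2 * ((d : ℝ) + 1))) *
          Real.exp (-(κ₀ / 6) * (supNorm (y₀' - y₀) + supNorm (x' - y₀) + supNorm (y - y₀)))) := Finset.sum_le_sum fun κ _ => (core κ).2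
    _ = _ := by rw [Finset.sum_const, Finset.card_univ, Fintype.card_fin, nsmul_eq_mul]; push_cast; ring

end PairingA

section PairingB

variable {L : ℕ} {κ₀ δ a aφ aρ g' CW : ℝ}
  {r : Fin (d + 1) → (Fin (d + 1) → ℤ) → Fin (d + 1) → (Fin (d + 1) → ℤ) → ℝ}
  {φ : Fin (d + 1) → (Fin (d + 1) → ℤ) → (Fin (d + 1) → ℤ) → ℝ} {ρ : (Fin (d + 1) → ℤ) → ℝ} {W : Tab d}
  {μ₀ : Fin (d + 1)} {y₀ : Fin (d + 1) → ℤ} {ν₀ : Fin (d + 1)} {y₀' : Fin (d + 1) → ℤ} {x' y : Fin (d + 1) → ℤ} {f b : Fib d}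
  (hL : 1 ≤ L) (hκ : 0 < κ₀) (hδ : 0 < δ) (hgap : κ₀ ≤ δ / 6 * L)
  (ha : 0 ≤ a) (haφ : 0 ≤ aφ) (haρ : 0 ≤ aρ) (hg : 0 ≤ g')
  (hφ : ∀ w, |φ μ₀ y₀ w| ≤ aφ * Real.exp (-(κ₀ * supNorm (quo L w - y₀))))
  (hr : ∀ κ v, |r ν₀ y₀' κ v| ≤ a * Real.exp (-(κ₀ * supNorm (quo L v - y₀'))))
  (hρ : ∀ x, |ρ x| ≤ aρ * Real.exp (-(κ₀ * supNorm (quo L x - x'))))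
  (hW : ∀ κ u κ' u' x z a b, |W κ u κ' u' x z a b| ≤ CW)
  (hD : ∀ κ' w v' x p, |∑ κ, (W κ (w - unitVec κ) κ' v' x p f b - W κ w κ' v' x p f b)|
    ≤ g' * Real.exp (-δ * l1 (v' - w)) * Real.exp (-δ * (l1 (x - w) + l1 (p - w))))

include hL hκ hr hW in
/-- [folklore] **THE FIRST-BOND DIVERGENCE OF THE VERTEX COLUMN OF A BLOCK-SUMMED TABLE, ENTRYWISE**: `divV (κ u ↦ vertexW r (bsum L ∘ W κ u) ν₀ y₀′) w`
`= Σ_κ′ Σ'_v′ r ν₀ y₀′ κ′ v′ · Σ_t Σ_κ (W κ (w−e_κ) κ′ v′ − W κ w κ′ v′)(x, L•y+t)`. -/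
theorem divV_vertexW_bsum_entry (w x : Fin (d + 1) → ℤ) :
    divV (fun κ u => vertexW r (fun μ w' => bsum L (W κ u μ w')) ν₀ y₀') w x y f b
      = ∑ κ', ∑' v', r ν₀ y₀' κ' v' * ∑ t ∈ box (d + 1) L,
          ∑ κ, (W κ (w - unitVec κ) κ' v' x ((L : ℤ) • y + toSite t) f b - W κ w κ' v' x ((L : ℤ) • y + toSite t) f b) := by
  have hB : ∀ κ u κ' v', |bsum L (W κ u κ' v') x y f b| ≤ (box (d + 1) L).card * CW := by
    intro κ u κ' v'
    rw [bsum_apply]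
    refine (Finset.abs_sum_le_sum_abs _ _).trans ?_
    refine (Finset.sum_le_sum fun t _ => hW κ u κ' v' x _ f b).trans (le_of_eq ?_)
    rw [Finset.sum_const, nsmul_eq_mul]
  have hs : ∀ κ u κ', Summable fun v' => r ν₀ y₀' κ' v' * bsum L (W κ u κ' v') x y f b :=
    fun κ u κ' => summable_env_mul hL hκ (hr κ') (hB κ u κ')
  rw [divV_apply_entry]
  simp only [vertexW_apply]
  calc ∑ κ, (∑ κ', ∑' v', r ν₀ y₀' κ' v' * bsum L (W κ (w - unitVec κ) κ' v') x y f b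
          - ∑ κ', ∑' v', r ν₀ y₀' κ' v' * bsum L (W κ w κ' v') x y f b)
      = ∑ κ, ∑ κ', ∑' v', r ν₀ y₀' κ' v' * (bsum L (W κ (w - unitVec κ) κ' v') x y f b - bsum L (W κ w κ' v') x y f b) := by
        refine Finset.sum_congr rfl fun κ _ => ?_
        rw [← Finset.sum_sub_distrib]
        refine Finset.sum_congr rfl fun κ' _ => ?_
        rw [← (hs κ _ κ').tsum_sub (hs κ _ κ')]
        exact tsum_congr fun v' => by ring
    _ = ∑ κ', ∑' v', ∑ κ, r ν₀ y₀' κ' v' * (bsum L (W κ (w - unitVec κ) κ' v') x y f b - bsum L (W κ w κ' v') x y f b) := by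
        rw [Finset.sum_comm]
        refine Finset.sum_congr rfl fun κ' _ => ?_
        rw [Summable.tsum_finsetSum fun κ _ => ?_]
        simp_rw [mul_sub]
        exact (hs κ _ κ').sub (hs κ _ κ')
    _ = _ := by
        refine Finset.sum_congr rfl fun κ' _ => tsum_congr fun v' => ?_
        rw [← Finset.mul_sum, Finset.sum_comm]
        simp only [bsum_apply, Finset.sum_sub_distrib]

include hL hκ hδ hgap ha haφ haρ hg hφ hr hρ hW hD in
/-- NOT IN PRINT; OUR PROOF.  **THE FIRST-BOND GAUGE PAIRING IS A `Cg·g′` TERM**: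
`|Σ'_x ρ x·Σ'_w φ μ₀ y₀ w·divV (κ u ↦ vertexW r (bsum L ∘ W κ u) ν₀ y₀′) w (x, y, f, b)| ≤ (d+1)·a_ρ·a_φ·a·g′·e^{5κ₀}·Zl(δ/2)³·L^{d+1}·Zl(κ₀/(2(d+1)))·e^{−(κ₀/6)·spread}`
(and the summand is summable). -/
theorem abs_pairingB_le :
    (Summable fun x => ρ x * ∑' w, φ μ₀ y₀ w * divV (fun κ u => vertexW r (fun μ w' => bsum L (W κ u μ w')) ν₀ y₀') w x y f b) ∧
    |∑' x, ρ x * ∑' w, φ μ₀ y₀ w * divV (fun κ u => vertexW r (fun μ w' => bsum L (W κ u μ w')) ν₀ y₀') w x y f b|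
      ≤ ((d : ℝ) + 1) * (aρ * aφ * a * g' * Real.exp κ₀ ^ 5 * Zl (d + 1) (δ / 2) ^ 3 *
        ((L : ℝ) ^ (d + 1) * Zl (d + 1) (κ₀ / (2 * ((d : ℝ) + 1))) *
          Real.exp (-(κ₀ / 6) * (supNorm (y₀' - y₀) + supNorm (x' - y₀) + supNorm (y - y₀))))) := by
  have hT : ∀ κ' w v' x p, |(fun w v' x p => ∑ κ, (W κ (w - unitVec κ) κ' v' x p f b - W κ w κ' v' x p f b)) w v' x p|
      ≤ g' * Real.exp (-δ * l1 (v' - w)) * Real.exp (-δ * (l1 (x - w) + l1 (p - w))) := fun κ' w v' x p => hD κ' w v' x p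
  have core := fun κ' => abs_threeLeg_sup_le (h₁ := fun w => φ μ₀ y₀ w) (h₂ := fun v' => r ν₀ y₀' κ' v') (ρ := ρ)
    (T := fun w v' x p => ∑ κ, (W κ (w - unitVec κ) κ' v' x p f b - W κ w κ' v' x p f b)) (c₁ := y₀) (c₂ := y₀') (c₃ := x') (c₄ := y)
    hL hκ hδ hgap haφ ha haρ hg hφ (fun v' => hr κ' v') hρ (hT κ')
  have mid := fun κ' x => middle_sup_le (h₁ := fun w => φ μ₀ y₀ w) (h₂ := fun v' => r ν₀ y₀' κ' v')
    (T := fun w v' x p => ∑ κ, (W κ (w - unitVec κ) κ' v' x p f b - W κ w κ' v' x p f b)) (c₁ := y₀) (c₂ := y₀') (c₄ := y)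
    hL hκ hδ hgap haφ ha hg hφ (fun v' => hr κ' v') (hT κ') x
  -- the `w`-layer as a finite sum over `κ'` of the scalar layers
  have eW : ∀ x, ρ x * ∑' w, φ μ₀ y₀ w * divV (fun κ u => vertexW r (fun μ w' => bsum L (W κ u μ w')) ν₀ y₀') w x y f b
      = ∑ κ', ρ x * ∑' w, φ μ₀ y₀ w * ∑' v', r ν₀ y₀' κ' v' * ∑ t ∈ box (d + 1) L,
          ∑ κ, (W κ (w - unitVec κ) κ' v' x ((L : ℤ) • y + toSite t) f b - W κ w κ' v' x ((L : ℤ) • y + toSite t) f b) := by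
    intro x
    calc ρ x * ∑' w, φ μ₀ y₀ w * divV (fun κ u => vertexW r (fun μ w' => bsum L (W κ u μ w')) ν₀ y₀') w x y f b
        = ρ x * ∑' w, ∑ κ', φ μ₀ y₀ w * ∑' v', r ν₀ y₀' κ' v' * ∑ t ∈ box (d + 1) L,
            ∑ κ, (W κ (w - unitVec κ) κ' v' x ((L : ℤ) • y + toSite t) f b - W κ w κ' v' x ((L : ℤ) • y + toSite t) f b) := by
          congr 1
          exact tsum_congr fun w => by rw [divV_vertexW_bsum_entry hL hκ hr hW, Finset.mul_sum _ _ (φ μ₀ y₀ w)]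
      _ = _ := by rw [Summable.tsum_finsetSum (fun κ' _ => (mid κ' x).1), Finset.mul_sum _ _ (ρ x)]
  simp_rw [eW]
  refine ⟨summable_sum fun κ' _ => (core κ').1, ?_⟩
  rw [Summable.tsum_finsetSum (fun κ' _ => (core κ').1)]
  calc |∑ κ', ∑' x, ρ x * ∑' w, φ μ₀ y₀ w * ∑' v', r ν₀ y₀' κ' v' * ∑ t ∈ box (d + 1) L,
          ∑ κ, (W κ (w - unitVec κ) κ' v' x ((L : ℤ) • y + toSite t) f b - W κ w κ' v' x ((L : ℤ) • y + toSite t) f b)|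
      ≤ ∑ κ', |∑' x, ρ x * ∑' w, φ μ₀ y₀ w * ∑' v', r ν₀ y₀' κ' v' * ∑ t ∈ box (d + 1) L,
          ∑ κ, (W κ (w - unitVec κ) κ' v' x ((L : ℤ) • y + toSite t) f b - W κ w κ' v' x ((L : ℤ) • y + toSite t) f b)| :=
        Finset.abs_sum_le_sum_abs _ _
    _ ≤ ∑ _κ' : Fin (d + 1), aρ * aφ * a * g' * Real.exp κ₀ ^ 5 * Zl (d + 1) (δ / 2) ^ 3 *
        ((L : ℝ) ^ (d + 1) * Zl (d + 1) (κ₀ / (2 * ((d : ℝ) + 1))) *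
          Real.exp (-(κ₀ / 6) * (supNorm (y₀' - y₀) + supNorm (x' - y₀) + supNorm (y - y₀)))) := Finset.sum_le_sum fun κ' _ => (core κ').2
    _ = _ := by rw [Finset.sum_const, Finset.card_univ, Fintype.card_fin, nsmul_eq_mul]; push_cast; ring

end PairingB

section PairingC

variable {L : ℕ} {κ₀ δ aφ aφ' aρ g' CW : ℝ}
  {φ : Fin (d + 1) → (Fin (d + 1) → ℤ) → (Fin (d + 1) → ℤ) → ℝ} {ρ : (Fin (d + 1) → ℤ) → ℝ} {W : Tab d}
  {μ₀ : Fin (d + 1)} {y₀ : Fin (d + 1) → ℤ} {ν₀ : Fin (d + 1)} {y₀' : Fin (d + 1) → ℤ} {x' y : Fin (d + 1) → ℤ} {f b : Fib d}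
  (hL : 1 ≤ L) (hκ : 0 < κ₀) (hδ : 0 < δ) (hgap : κ₀ ≤ δ / 6 * L)
  (haφ : 0 ≤ aφ) (haφ' : 0 ≤ aφ') (haρ : 0 ≤ aρ) (hg : 0 ≤ g')
  (hφ : ∀ w, |φ μ₀ y₀ w| ≤ aφ * Real.exp (-(κ₀ * supNorm (quo L w - y₀))))
  (hφ' : ∀ w', |φ ν₀ y₀' w'| ≤ aφ' * Real.exp (-(κ₀ * supNorm (quo L w' - y₀'))))
  (hρ : ∀ x, |ρ x| ≤ aρ * Real.exp (-(κ₀ * supNorm (quo L x - x'))))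
  (hW : ∀ κ u κ' u' x z a b, |W κ u κ' u' x z a b| ≤ CW)
  (hD : ∀ κ v w x p, |∑ μ, (W κ v μ (w - unitVec μ) x p f b - W κ v μ w x p f b)|
    ≤ g' * Real.exp (-δ * l1 (w - v)) * Real.exp (-δ * (l1 (x - v) + l1 (p - v))))

include hL hκ hφ' hW in
/-- [folklore] **THE FIRST-BOND DIVERGENCE OF THE GAUGE-PAIRED COLUMN `P₂` OF A BLOCK-SUMMED TABLE, ENTRYWISE**:
`divV P₂ w (x,y,f,b) = Σ'_w′ φ ν₀ y₀′ w′ · Σ_t Σ_κ [D(κ, w−e_κ; w′) − D(κ, w; w′)](x, L•y+t)`, `D(κ,u;w′) := Σ_μ (W κ u μ (w′−e_μ) − W κ u μ w′)`. -/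
theorem divV_P₂_bsum_entry (w x : Fin (d + 1) → ℤ) :
    divV (fun κ u => fun x z f b => ∑' w', φ ν₀ y₀' w' * divV (fun μ w'' => bsum L (W κ u μ w'')) w' x z f b) w x y f b
      = ∑' w', φ ν₀ y₀' w' * ∑ t ∈ box (d + 1) L, ∑ κ,
          ((∑ μ, (W κ (w - unitVec κ) μ (w' - unitVec μ) x ((L : ℤ) • y + toSite t) f b - W κ (w - unitVec κ) μ w' x ((L : ℤ) • y + toSite t) f b))
            - ∑ μ, (W κ w μ (w' - unitVec μ) x ((L : ℤ) • y + toSite t) f b - W κ w μ w' x ((L : ℤ) • y + toSite t) f b)) := by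
  have hB : ∀ κ u w', |divV (fun μ w'' => bsum L (W κ u μ w'')) w' x y f b| ≤ (box (d + 1) L).card * (((d : ℝ) + 1) * (CW + CW)) := by
    intro κ u w'
    rw [divV_bsum_entry]
    refine (Finset.abs_sum_le_sum_abs _ _).trans ((Finset.sum_le_sum fun t _ => ?_).trans (le_of_eq (by rw [Finset.sum_const, nsmul_eq_mul])))
    refine (Finset.abs_sum_le_sum_abs _ _).trans ((Finset.sum_le_sum fun μ _ =>
      (abs_sub _ _).trans (add_le_add (hW _ _ _ _ _ _ _ _) (hW _ _ _ _ _ _ _ _))).trans (le_of_eq ?_))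
    rw [Finset.sum_const, Finset.card_univ, Fintype.card_fin, nsmul_eq_mul]; push_cast; ring
  have hs : ∀ κ u, Summable fun w' => φ ν₀ y₀' w' * divV (fun μ w'' => bsum L (W κ u μ w'')) w' x y f b :=
    fun κ u => summable_env_mul hL hκ hφ' (hB κ u)
  rw [divV_apply_entry]
  calc ∑ κ, (∑' w', φ ν₀ y₀' w' * divV (fun μ w'' => bsum L (W κ (w - unitVec κ) μ w'')) w' x y f b
          - ∑' w', φ ν₀ y₀' w' * divV (fun μ w'' => bsum L (W κ w μ w'')) w' x y f b)
      = ∑ κ, ∑' w', φ ν₀ y₀' w' * (divV (fun μ w'' => bsum L (W κ (w - unitVec κ) μ w'')) w' x y f b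
          - divV (fun μ w'' => bsum L (W κ w μ w'')) w' x y f b) := by
        refine Finset.sum_congr rfl fun κ _ => ?_
        rw [← (hs κ _).tsum_sub (hs κ _)]
        exact tsum_congr fun w' => by ring
    _ = ∑' w', ∑ κ, φ ν₀ y₀' w' * (divV (fun μ w'' => bsum L (W κ (w - unitVec κ) μ w'')) w' x y f b
          - divV (fun μ w'' => bsum L (W κ w μ w'')) w' x y f b) := by
        rw [Summable.tsum_finsetSum fun κ _ => ?_]
        simp_rw [mul_sub]
        exact (hs κ _).sub (hs κ _)
    _ = _ := by
        refine tsum_congr fun w' => ?_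
        rw [← Finset.mul_sum]
        congr 1
        rw [Finset.sum_comm]
        refine Finset.sum_congr rfl fun κ _ => ?_
        rw [divV_bsum_entry, divV_bsum_entry, ← Finset.sum_sub_distrib]

include hL hκ hδ hgap haφ haφ' haρ hg hφ hφ' hρ hW hD in
/-- NOT IN PRINT; OUR PROOF.  **THE DOUBLE GAUGE PAIRING IS A `Cg·g′` TERM**: with `P₂` as above,
`|Σ'_x ρ x·Σ'_w φ μ₀ y₀ w·divV P₂ w (x, y, f, b)| ≤ a_ρ·a_φ·a_φ′·((d+1)·g′·(e^{3δ}+1))·e^{5κ₀}·Zl(δ/2)³·L^{d+1}·Zl(κ₀/(2(d+1)))·e^{−(κ₀/6)·spread}`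
(the shifted row re-centred by `SlotDivergenceLetters.exp_shift_unit_le`; the summand is summable). -/
theorem abs_pairingC_le :
    (Summable fun x => ρ x * ∑' w, φ μ₀ y₀ w *
      divV (fun κ u => fun x z f b => ∑' w', φ ν₀ y₀' w' * divV (fun μ w'' => bsum L (W κ u μ w'')) w' x z f b) w x y f b) ∧
    |∑' x, ρ x * ∑' w, φ μ₀ y₀ w *
      divV (fun κ u => fun x z f b => ∑' w', φ ν₀ y₀' w' * divV (fun μ w'' => bsum L (W κ u μ w'')) w' x z f b) w x y f b|
      ≤ aρ * aφ * aφ' * (((d : ℝ) + 1) * (g' * (Real.exp δ ^ 3 + 1))) * Real.exp κ₀ ^ 5 * Zl (d + 1) (δ / 2) ^ 3 *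
        ((L : ℝ) ^ (d + 1) * Zl (d + 1) (κ₀ / (2 * ((d : ℝ) + 1))) *
          Real.exp (-(κ₀ / 6) * (supNorm (y₀' - y₀) + supNorm (x' - y₀) + supNorm (y - y₀)))) := by
  -- re-centring the shifted divergence row
  have hsh : ∀ (w w' x p : Fin (d + 1) → ℤ) (κ : Fin (d + 1)),
      Real.exp (-δ * l1 (w' - (w - unitVec κ))) * Real.exp (-δ * (l1 (x - (w - unitVec κ)) + l1 (p - (w - unitVec κ))))
        ≤ Real.exp δ ^ 3 * (Real.exp (-δ * l1 (w' - w)) * Real.exp (-δ * (l1 (x - w) + l1 (p - w)))) := by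
    intro w w' x p κ
    -- `SlotDivergenceLetters.exp_shift_unit_le` BY NAME (stated with `AffineAveraging.unitVec`; `B6AxialGaugeDictionary.unitVec_eq` bridges the spelling)
    have esh : ∀ a' : Fin (d + 1) → ℤ, Real.exp (-δ * l1 (a' - (w - unitVec κ))) ≤ Real.exp δ * Real.exp (-δ * l1 (a' - w)) :=
      fun a' => by simpa only [unitVec_eq] using exp_shift_unit_le hδ.le a' w κ
    have e1 := esh w'
    have e2 := esh x
    have e3 := esh p
    rw [show -δ * (l1 (x - (w - unitVec κ)) + l1 (p - (w - unitVec κ)))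
        = -δ * l1 (x - (w - unitVec κ)) + -δ * l1 (p - (w - unitVec κ)) by ring, Real.exp_add,
      show -δ * (l1 (x - w) + l1 (p - w)) = -δ * l1 (x - w) + -δ * l1 (p - w) by ring, Real.exp_add]
    calc Real.exp (-δ * l1 (w' - (w - unitVec κ))) * (Real.exp (-δ * l1 (x - (w - unitVec κ))) * Real.exp (-δ * l1 (p - (w - unitVec κ))))
        ≤ (Real.exp δ * Real.exp (-δ * l1 (w' - w))) * ((Real.exp δ * Real.exp (-δ * l1 (x - w))) * (Real.exp δ * Real.exp (-δ * l1 (p - w)))) := by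
          gcongr
      _ = _ := by ring
  have hT : ∀ w w' x p, |(fun w w' x p => ∑ κ, ((∑ μ, (W κ (w - unitVec κ) μ (w' - unitVec μ) x p f b - W κ (w - unitVec κ) μ w' x p f b))
        - ∑ μ, (W κ w μ (w' - unitVec μ) x p f b - W κ w μ w' x p f b))) w w' x p|
      ≤ ((d : ℝ) + 1) * (g' * (Real.exp δ ^ 3 + 1)) * Real.exp (-δ * l1 (w' - w)) * Real.exp (-δ * (l1 (x - w) + l1 (p - w))) := by
    intro w w' x p
    dsimp only
    refine (Finset.abs_sum_le_sum_abs _ _).trans ?_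
    refine (Finset.sum_le_sum fun κ _ => (abs_sub _ _).trans (add_le_add ((hD κ _ w' x p).trans
      (mul_le_mul_of_nonneg_left (hsh w w' x p κ) hg |>.trans_eq' (by ring))) (hD κ w w' x p))).trans (le_of_eq ?_)
    rw [Finset.sum_const, Finset.card_univ, Fintype.card_fin, nsmul_eq_mul]; push_cast; ring
  have core := abs_threeLeg_sup_le (h₁ := fun w => φ μ₀ y₀ w) (h₂ := fun w' => φ ν₀ y₀' w') (ρ := ρ)
    (T := fun w w' x p => ∑ κ, ((∑ μ, (W κ (w - unitVec κ) μ (w' - unitVec μ) x p f b - W κ (w - unitVec κ) μ w' x p f b))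
        - ∑ μ, (W κ w μ (w' - unitVec μ) x p f b - W κ w μ w' x p f b))) (c₁ := y₀) (c₂ := y₀') (c₃ := x') (c₄ := y)
    hL hκ hδ hgap haφ haφ' haρ (by positivity) hφ hφ' hρ hT
  simp_rw [divV_P₂_bsum_entry hL hκ hφ' hW]
  exact core

end PairingC

end Summit.QuantumFields.BalabanUV.Beta.GAN24.LegPushGaugePairings

end
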